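import Summits.ResolutionOfSingularities.ResolutionOfSingularities.Theorems.FrobeniusLadderFInjectiveMacaulayficationRegularTower
import Summits.ResolutionOfSingularities.ResolutionOfSingularities.Theorems.FrobeniusLadderFInjectiveMacaulayficationE4FloorTwoGlue
import HarnessLib

/-!
# (RR-I) THE FIRST KERNEL INSTANCE OF PROGRAMME «RR»: the reduced-singular-locus tower of `G = {X₀X₁ + X₂³ + X₃³ + X₄³}` (char 2) has height EXACTLY two from `G`,
# EXACTLY one from every `𝔪`-floor `S′ ≅ Bl_𝔪 G`
# (crux `FInjectiveMacaulayfication` stmt-ResolutionOfSingularities-15315, chain w45a; res-L1-w45a-plan-1 RULINGS R19.8 (3) / R19.8a (3″); over res-L1-w45a-lead-1 g9's (RR-K)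
# `RegTower` p634003 and this seat's E4″ row `E4FloorTwoGlue` p633422; seat res-L1-w45a-stub-1 g11)

[OURS · L1 W4.5a] Support file (`--supports stmt-ResolutionOfSingularities-15315 --as helper`); replaces the role of NO printed item; NOT a statement of any
manuscript; def-free; UNCONDITIONAL. AI-written (AI review is weaker than expert review).

The recipe of record `RegTower.singCentre p S = vanishingIdeal ⟨closure (Reg S)ᶜ⟩` (the prime `p` is not used); `RegTower.TowerRegular c p n S` (every chain of `n` blowing
ups along the successive `c`-centres ends regular at every point).
* §1 generic: `preimage_compl_regularLocus_of_iso`, ★ `comap_singCentre_of_iso` (`(singCentre p T).comap e.hom = singCentre p S` for `e : S ≅ T`: the recipe commutes with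
  isomorphisms), `towerRegular_zero_of_iso`.
* §2 floor 0: `not_isRegularLocalRing_iff_vertex` (`Sing(G) = V(𝔪)` ring-side), `compl_regularLocus_eq_vertex`, ★ `singCentre_G_eq_idealSheaf` (`singCentre p G = 𝔪̃`),
  `not_towerRegular_zero_G`.
* §3 floor 1: `singCentre_affineBlowup_eq` (`singCentre p (Bl_𝔪 G) = vanishingIdeal ⟨(Reg Bl_𝔪 G)ᶜ⟩` — res-L1-w45a-lead-1's `isClosed_compl_regularLocus`),
  `exists_not_mem_regularLocus_affineBlowup` (a singular point: the generic point of the curve `V(J₂)` on the chart `D₊(w₁)`),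
  ★★ `towerRegular_one_floor` (`TowerRegular singCentre p 1 S′` for EVERY blowing up `S′ → G` along `𝔪̃`), ★ `not_towerRegular_zero_floor`.
* §4 ★★★ `towerRegular_two_G`, `not_towerRegular_one_G`, `towerHeight_G` — the `singCentre`-tower of `G` regularizes at height EXACTLY two; `towerHeight_floor` — of every
  `𝔪`-floor at height EXACTLY one. ONE tower instance (global floors; the germ floors over `Spec 𝒪_{G,v}` are the T″-instance p633422); evidence for nothing beyond itself;
  R19.7's escalator (the F-side `N_red` recipe on non-FULL floors) does not bear on it.
[folklore assembly; cite: GortzWedhorn2020, Prop. 13.91 (2), (13.19); Liu2002, Thm. 8.1.19 (a); StacksProject, Tag 0804]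
-/

-- single-problem summit: the doubled namespace component is forced
set_option linter.dupNamespace false

noncomputable section

namespace Summit.ResolutionOfSingularities.ResolutionOfSingularities.Theorems.FInjectiveMacaulayfication.RegTower.InstanceE4

open MvPolynomial Literature.AlgebraicGeometry.Resolution AlgebraicGeometry CategoryTheory CategoryTheory.Limits TopologicalSpace
open Summit.ResolutionOfSingularities.ResolutionOfSingularities.Theorems.FInjectiveMacaulayfication
open Summit.ResolutionOfSingularities.ResolutionOfSingularities.Theorems.FInjectiveMacaulayfication.RegTower

/-! ## §1 The recipe commutes with isomorphisms -/

/-- Along an isomorphism `e : S ≅ T`: `e⁻¹ (Reg T)ᶜ = (Reg S)ᶜ`. [folklore] -/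
theorem preimage_compl_regularLocus_of_iso {S T : Scheme.{0}} (e : S ≅ T) :
    e.hom.base ⁻¹' (Scheme.regularLocus T)ᶜ = (Scheme.regularLocus S)ᶜ := by
  ext s
  rw [Set.mem_preimage, Set.mem_compl_iff, Set.mem_compl_iff, ← mem_regularLocus_iff_of_flat_of_isPreimmersion e.hom s]

/-- ★ **`singCentre` commutes with isomorphisms**: `(singCentre p T).comap e.hom = singCentre p S` for `e : S ≅ T` (`comap_vanishingIdeal_of_isOpenImmersion`;
homeomorphisms commute with closures). [folklore] -/
theorem comap_singCentre_of_iso (p : ℕ) {S T : Scheme.{0}} (e : S ≅ T) : (singCentre p T).comap e.hom = singCentre p S := by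
  change (Scheme.IdealSheafData.vanishingIdeal _).comap e.hom = Scheme.IdealSheafData.vanishingIdeal _
  rw [comap_vanishingIdeal_of_isOpenImmersion]
  congr 1
  ext1
  change e.hom.base ⁻¹' closure ((Scheme.regularLocus T)ᶜ) = closure ((Scheme.regularLocus S)ᶜ)
  rw [← preimage_compl_regularLocus_of_iso e, ← Scheme.coe_homeoOfIso, Homeomorph.preimage_closure]

/-- Floor zero transports along isomorphisms. [plumbing] -/
theorem towerRegular_zero_of_iso {c : ∀ (_p : ℕ) (S : Scheme.{0}), S.IdealSheafData} {p : ℕ} {S T : Scheme.{0}} (e : S ≅ T)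
    (h : TowerRegular c p 0 T) : TowerRegular c p 0 S :=
  fun s => (mem_regularLocus_iff_of_flat_of_isPreimmersion e.hom s).mpr (h (e.hom.base s))

/-! ## §2 Floor 0: `singCentre p G = 𝔪̃`; `G` is not regular -/

/-- **`Sing(G) = V(𝔪)` ring-side**: a prime `P` of `A = k[X]/(f)` has `A_P` non-regular iff `P ⊇ 𝔪` (`E4GermSpecimen.regular_off_vertex`, `vertex_not_mem_regularLocus`). [folklore] -/
theorem not_isRegularLocalRing_iff_vertex (k : Type) [Field k] [CharP k 2] (f : MvPolynomial (Fin 5) k)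
    (hf : f = X 0 * X 1 + X 2 ^ 3 + X 3 ^ 3 + X 4 ^ 3)
    (𝔪 : Ideal (MvPolynomial (Fin 5) k ⧸ Ideal.span {f})) (h𝔪 : 𝔪 = Ideal.span (Set.range fun j : Fin 5 => Ideal.Quotient.mk (Ideal.span {f}) (X j)))
    (P : Ideal (MvPolynomial (Fin 5) k ⧸ Ideal.span {f})) [P.IsPrime] :
    ¬ IsRegularLocalRing (Localization.AtPrime P) ↔ 𝔪 ≤ P := by
  subst h𝔪
  have hmax : (Ideal.span (Set.range fun j : Fin 5 => Ideal.Quotient.mk (Ideal.span {f}) (X j))).IsMaximal :=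
    DoublePointFermatCubicGerm.isMaximal_origin k f (E4GermSpecimen.constantCoeff_f k f hf)
  constructor
  · intro h
    by_contra hle
    exact h (E4GermSpecimen.regular_off_vertex k f hf P hle)
  · intro hle hreg
    have hP : P = Ideal.span (Set.range fun j : Fin 5 => Ideal.Quotient.mk (Ideal.span {f}) (X j)) := (hmax.eq_of_le ‹P.IsPrime›.ne_top hle).symm
    let v : Spec (.of (MvPolynomial (Fin 5) k ⧸ Ideal.span {f})) := ⟨P, ‹P.IsPrime›⟩
    have hv := E4GermSpecimen.vertex_not_mem_regularLocus k f hf v hP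
    rw [regularLocus_Spec_eq] at hv
    exact hv hreg

/-- **`(Reg G)ᶜ = {v}`** as sets. [folklore] -/
theorem compl_regularLocus_eq_vertex (k : Type) [Field k] [CharP k 2] (f : MvPolynomial (Fin 5) k)
    (hf : f = X 0 * X 1 + X 2 ^ 3 + X 3 ^ 3 + X 4 ^ 3)
    (v : Spec (.of (MvPolynomial (Fin 5) k ⧸ Ideal.span {f})))
    (hv : v.asIdeal = Ideal.span (Set.range fun j : Fin 5 => Ideal.Quotient.mk (Ideal.span {f}) (X j))) :
    (Scheme.regularLocus (Spec (.of (MvPolynomial (Fin 5) k ⧸ Ideal.span {f}))))ᶜ = {v} := by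
  ext w
  rw [Set.mem_compl_iff, regularLocus_Spec_eq, Set.mem_setOf_eq, not_isRegularLocalRing_iff_vertex k f hf _ rfl w.asIdeal, Set.mem_singleton_iff, ← hv]
  have hmax : v.asIdeal.IsMaximal := by rw [hv]; exact DoublePointFermatCubicGerm.isMaximal_origin k f (E4GermSpecimen.constantCoeff_f k f hf)
  exact ⟨fun h => PrimeSpectrum.ext (hmax.eq_of_le w.isPrime.ne_top h).symm, fun h => h ▸ le_rfl⟩

/-- ★ **`singCentre p G = 𝔪̃`**: the reduced ideal sheaf of the closure of the singular locus of `G` is the vertex ideal sheaf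
(`E4FloorTwoGlue.comap_vanishingIdeal_eq_idealSheaf` along the identity; `𝔪` maximal hence radical; `{v}` closed). [folklore] -/
theorem singCentre_G_eq_idealSheaf (k : Type) [Field k] [CharP k 2] (f : MvPolynomial (Fin 5) k)
    (hf : f = X 0 * X 1 + X 2 ^ 3 + X 3 ^ 3 + X 4 ^ 3)
    (𝔪 : Ideal (MvPolynomial (Fin 5) k ⧸ Ideal.span {f})) (h𝔪 : 𝔪 = Ideal.span (Set.range fun j : Fin 5 => Ideal.Quotient.mk (Ideal.span {f}) (X j))) (p : ℕ) :
    singCentre p (Spec (.of (MvPolynomial (Fin 5) k ⧸ Ideal.span {f}))) = affineBlowup.idealSheaf 𝔪 := by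
  let v : Spec (.of (MvPolynomial (Fin 5) k ⧸ Ideal.span {f})) :=
    ⟨Ideal.span (Set.range fun j : Fin 5 => Ideal.Quotient.mk (Ideal.span {f}) (X j)),
      (DoublePointFermatCubicGerm.isMaximal_origin k f (E4GermSpecimen.constantCoeff_f k f hf)).isPrime⟩
  have hv : v.asIdeal = Ideal.span (Set.range fun j : Fin 5 => Ideal.Quotient.mk (Ideal.span {f}) (X j)) := rfl
  have hcl : IsClosed ((Scheme.regularLocus (Spec (.of (MvPolynomial (Fin 5) k ⧸ Ideal.span {f}))))ᶜ) := by
    rw [compl_regularLocus_eq_vertex k f hf v hv]; exact E4GermSpecimen.isClosed_vertex k f hf v hv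
  have hZ : ((⟨closure ((Scheme.regularLocus (Spec (.of (MvPolynomial (Fin 5) k ⧸ Ideal.span {f}))))ᶜ), isClosed_closure⟩ :
      Closeds (Spec (.of (MvPolynomial (Fin 5) k ⧸ Ideal.span {f})))) : Set (Spec (.of (MvPolynomial (Fin 5) k ⧸ Ideal.span {f})))) =
      (Scheme.regularLocus (Spec (.of (MvPolynomial (Fin 5) k ⧸ Ideal.span {f}))))ᶜ := hcl.closure_eq
  have hrad : 𝔪.radical = 𝔪 := by
    rw [h𝔪]; exact (DoublePointFermatCubicGerm.isMaximal_origin k f (E4GermSpecimen.constantCoeff_f k f hf)).isPrime.radical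
  have key := E4FloorTwoGlue.comap_vanishingIdeal_eq_idealSheaf _ hZ (𝟙 (Spec (.of (MvPolynomial (Fin 5) k ⧸ Ideal.span {f})))) 𝔪 hrad
    fun P _ => not_isRegularLocalRing_iff_vertex k f hf 𝔪 h𝔪 P
  rw [Scheme.IdealSheafData.comap_id] at key
  exact key

/-- **`G` is not regular** (floor zero of its tower fails): the vertex is a singular point. [folklore] -/
theorem not_towerRegular_zero_G (k : Type) [Field k] [CharP k 2] (f : MvPolynomial (Fin 5) k) (hf : f = X 0 * X 1 + X 2 ^ 3 + X 3 ^ 3 + X 4 ^ 3) (p : ℕ) :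
    ¬ TowerRegular singCentre p 0 (Spec (.of (MvPolynomial (Fin 5) k ⧸ Ideal.span {f}))) := by
  intro h
  let v : Spec (.of (MvPolynomial (Fin 5) k ⧸ Ideal.span {f})) :=
    ⟨Ideal.span (Set.range fun j : Fin 5 => Ideal.Quotient.mk (Ideal.span {f}) (X j)),
      (DoublePointFermatCubicGerm.isMaximal_origin k f (E4GermSpecimen.constantCoeff_f k f hf)).isPrime⟩
  exact E4GermSpecimen.vertex_not_mem_regularLocus k f hf v rfl (h v)

/-! ## §3 Floor 1: every `𝔪`-floor `S′ ≅ Bl_𝔪 G` has `singCentre`-tower height exactly one -/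

/-- **`singCentre p (Bl_𝔪 G) = vanishingIdeal ⟨(Reg Bl_𝔪 G)ᶜ⟩`** — the singular locus of `Bl_𝔪 G` is closed (res-L1-w45a-lead-1's `E4GermSingularCentre.isClosed_compl_regularLocus`),
so the closure in the recipe is cosmetic. [plumbing] -/
theorem singCentre_affineBlowup_eq (k : Type) [Field k] (f : MvPolynomial (Fin 5) k) (𝔪 : Ideal (MvPolynomial (Fin 5) k ⧸ Ideal.span {f})) (p : ℕ) :
    singCentre p (affineBlowup 𝔪) =
      Scheme.IdealSheafData.vanishingIdeal ⟨(Scheme.regularLocus (affineBlowup 𝔪))ᶜ, E4GermSingularCentre.isClosed_compl_regularLocus k f 𝔪⟩ := by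
  change Scheme.IdealSheafData.vanishingIdeal _ = _
  congr 1
  ext1
  exact (E4GermSingularCentre.isClosed_compl_regularLocus k f 𝔪).closure_eq

/-- **`Bl_𝔪 G` has a singular point**: the generic point of the curve `V(J₂) = V(a′, b′, w₁, 1 + U³ + V³)` on the chart `D₊(w₁) ≅ Spec k[X]/(g₂)` (`J₂` prime,
`E4FloorTwoCharts.isPrime_chartTwo`; singular by `E4FloorTwoWChart.not_isRegularLocalRing_iff_chartTwo`; moved into `Bl_𝔪 G` along the open immersion
`StrictTransformChartN.stub_strictTransformChartN` ∘ `affineBlowup.chartι`). [folklore] -/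
theorem exists_not_mem_regularLocus_affineBlowup (k : Type) [Field k] [CharP k 2] (f : MvPolynomial (Fin 5) k)
    (hf : f = X 0 * X 1 + X 2 ^ 3 + X 3 ^ 3 + X 4 ^ 3)
    (𝔪 : Ideal (MvPolynomial (Fin 5) k ⧸ Ideal.span {f})) (h𝔪 : 𝔪 = Ideal.span (Set.range fun j : Fin 5 => Ideal.Quotient.mk (Ideal.span {f}) (X j))) :
    ∃ x₁ : ↥(affineBlowup 𝔪), x₁ ∉ Scheme.regularLocus (affineBlowup 𝔪) := by
  subst h𝔪
  have h3 := E4FloorTwoGlue.three_ne_zero_of_charP_two k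
  have hprime := E4GermSpecimen.prime_f k f hf
  haveI hfprime : (Ideal.span {f}).IsPrime := (Ideal.span_singleton_prime hprime.ne_zero).mpr hprime
  obtain ⟨g₂, hg₂⟩ : ∃ g₂ : MvPolynomial (Fin 5) k, g₂ = X 0 * X 1 + X 2 * (1 + X 3 ^ 3 + X 4 ^ 3) := ⟨_, rfl⟩
  have hθ : MvPolynomial.aeval (fun j : Fin 5 => if j = 2 then (X 2 : MvPolynomial (Fin 5) k) else X j * X 2) f = X 2 ^ 2 * g₂ := by
    rw [hg₂]; exact E4GermPointBlowupFull.theta k f hf 2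
  have hfX := E4GermPointBlowupFull.f_not_mem_span_X k f hf 2
  have hgX : g₂ ∉ Ideal.span {(X 2 : MvPolynomial (Fin 5) k)} := by rw [hg₂]; exact E4GermPointBlowupFull.g_not_mem_span_X k 2
  have hgprime : (Ideal.span {g₂}).IsPrime := (PrimeTransfer.stub_primeTransfer k 5 2 f g₂ 2 hθ hfX hgX).mp hfprime
  have hXg : (X 2 : MvPolynomial (Fin 5) k) ∉ Ideal.span {g₂} := PrimeTransfer.X_not_mem_span_of_isPrime hgprime hgX
  obtain ⟨e, -⟩ := StrictTransformChartN.stub_strictTransformChartN k 5 f g₂ 2 2 hfprime hprime.ne_zero hgprime hXg hθ _ rfl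
  let ι : Spec (.of (MvPolynomial (Fin 5) k ⧸ Ideal.span {g₂})) ⟶ affineBlowup (Ideal.span (Set.range fun j : Fin 5 => Ideal.Quotient.mk (Ideal.span {f}) (X j))) :=
    Spec.map e.symm.toCommRingCatIso.hom ≫ affineBlowup.chartι (Ideal.Quotient.mk (Ideal.span {f}) (X 2)) (Ideal.subset_span (Set.mem_range_self 2))
  -- the singular generic point of the curve on the chart
  obtain ⟨c₂, hc₂⟩ : ∃ c₂ : Fin 4 → MvPolynomial (Fin 5) k, c₂ = ![X 0, X 1, X 2, 1 + X 3 ^ 3 + X 4 ^ 3] := ⟨_, rfl⟩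
  haveI hJ := E4FloorTwoCharts.isPrime_chartTwo k h3 g₂ hg₂ c₂ hc₂ _ rfl
  let P₀ : Spec (.of (MvPolynomial (Fin 5) k ⧸ Ideal.span {g₂})) := ⟨(Ideal.span (Set.range c₂)).map (Ideal.Quotient.mk (Ideal.span {g₂})), hJ⟩
  have hP₀ : P₀ ∉ Scheme.regularLocus (Spec (.of (MvPolynomial (Fin 5) k ⧸ Ideal.span {g₂}))) := by
    rw [regularLocus_Spec_eq, Set.mem_setOf_eq, not_not.symm.not, not_not,
      E4FloorTwoWChart.not_isRegularLocalRing_iff_chartTwo k h3 g₂ hg₂ c₂ hc₂ _ rfl P₀.asIdeal]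
  exact ⟨ι.base P₀, fun h => hP₀ ((mem_regularLocus_iff_of_flat_of_isPreimmersion ι P₀).mpr h)⟩

/-- ★★ **Every `𝔪`-floor has a regular `singCentre`-blow-up**: for EVERY blowing up `g : S′ → G` along the vertex ideal `𝔪̃`, `TowerRegular singCentre p 1 S′` — every blowing up of
`S′` along `singCentre p S′` is regular at every point (`S′ ≅ Bl_𝔪 G` by uniqueness; the centre is the transported reduced singular locus, §1; then this seat's E4″ theorem
`E4FloorTwoGlue.isRegular_of_isBlowup_vanishingIdeal`, p633422). [OURS · instance; cite: GortzWedhorn2020, Prop. 13.91 (2); Liu2002, Thm. 8.1.19 (a)] -/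
theorem towerRegular_one_floor (k : Type) [Field k] [CharP k 2] (f : MvPolynomial (Fin 5) k)
    (hf : f = X 0 * X 1 + X 2 ^ 3 + X 3 ^ 3 + X 4 ^ 3)
    (𝔪 : Ideal (MvPolynomial (Fin 5) k ⧸ Ideal.span {f})) (h𝔪 : 𝔪 = Ideal.span (Set.range fun j : Fin 5 => Ideal.Quotient.mk (Ideal.span {f}) (X j))) (p : ℕ)
    (S' : Scheme.{0}) (g : S' ⟶ Spec (.of (MvPolynomial (Fin 5) k ⧸ Ideal.span {f}))) (hg : IsBlowup g (affineBlowup.idealSheaf 𝔪)) :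
    TowerRegular singCentre p 1 S' := by
  intro S₂ g₂ hg₂
  obtain ⟨e, -, -⟩ := hg.unique (affineBlowup.isBlowup 𝔪)
  have h2 := hg₂.comp_iso e
  rw [show e.inv = e.symm.hom from rfl, comap_singCentre_of_iso p e.symm, singCentre_affineBlowup_eq k f 𝔪 p] at h2
  have hreg := E4FloorTwoGlue.isRegular_of_isBlowup_vanishingIdeal k f hf 𝔪 h𝔪 _ rfl (g₂ ≫ e.hom) h2
  exact fun s => (Scheme.mem_regularLocus s).mpr (hreg s)

/-- ★ **No `𝔪`-floor is regular** (floor zero of its tower fails). [OURS · instance] -/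
theorem not_towerRegular_zero_floor (k : Type) [Field k] [CharP k 2] (f : MvPolynomial (Fin 5) k)
    (hf : f = X 0 * X 1 + X 2 ^ 3 + X 3 ^ 3 + X 4 ^ 3)
    (𝔪 : Ideal (MvPolynomial (Fin 5) k ⧸ Ideal.span {f})) (h𝔪 : 𝔪 = Ideal.span (Set.range fun j : Fin 5 => Ideal.Quotient.mk (Ideal.span {f}) (X j))) (p : ℕ)
    (S' : Scheme.{0}) (g : S' ⟶ Spec (.of (MvPolynomial (Fin 5) k ⧸ Ideal.span {f}))) (hg : IsBlowup g (affineBlowup.idealSheaf 𝔪)) :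
    ¬ TowerRegular singCentre p 0 S' := by
  intro h
  obtain ⟨e, -, -⟩ := hg.unique (affineBlowup.isBlowup 𝔪)
  obtain ⟨x₁, hx₁⟩ := exists_not_mem_regularLocus_affineBlowup k f hf 𝔪 h𝔪
  exact hx₁ (towerRegular_zero_of_iso e.symm h x₁)

/-- **Height EXACTLY one for every `𝔪`-floor.** [OURS · instance] -/
theorem towerHeight_floor (k : Type) [Field k] [CharP k 2] (f : MvPolynomial (Fin 5) k)
    (hf : f = X 0 * X 1 + X 2 ^ 3 + X 3 ^ 3 + X 4 ^ 3)
    (𝔪 : Ideal (MvPolynomial (Fin 5) k ⧸ Ideal.span {f})) (h𝔪 : 𝔪 = Ideal.span (Set.range fun j : Fin 5 => Ideal.Quotient.mk (Ideal.span {f}) (X j))) (p : ℕ)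
    (S' : Scheme.{0}) (g : S' ⟶ Spec (.of (MvPolynomial (Fin 5) k ⧸ Ideal.span {f}))) (hg : IsBlowup g (affineBlowup.idealSheaf 𝔪)) :
    TowerRegular singCentre p 1 S' ∧ ¬ TowerRegular singCentre p 0 S' :=
  ⟨towerRegular_one_floor k f hf 𝔪 h𝔪 p S' g hg, not_towerRegular_zero_floor k f hf 𝔪 h𝔪 p S' g hg⟩

/-! ## §4 The tower of `G`: height exactly two -/

/-- ★★★ **`TowerRegular singCentre p 2 G`**: the reduced-singular-locus tower of `G = {X₀X₁ + X₂³ + X₃³ + X₄³}` (char 2, any field) regularizes at height two —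
floor 1 along `singCentre p G = 𝔪̃` (§2), floor 2 along the reduced singular locus of the floor (§3). [OURS · instance] -/
theorem towerRegular_two_G (k : Type) [Field k] [CharP k 2] (f : MvPolynomial (Fin 5) k) (hf : f = X 0 * X 1 + X 2 ^ 3 + X 3 ^ 3 + X 4 ^ 3) (p : ℕ) :
    TowerRegular singCentre p 2 (Spec (.of (MvPolynomial (Fin 5) k ⧸ Ideal.span {f}))) := by
  intro S₁ g₁ hg₁
  rw [singCentre_G_eq_idealSheaf k f hf _ rfl p] at hg₁
  exact towerRegular_one_floor k f hf _ rfl p S₁ g₁ hg₁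

/-- ★ **`¬ TowerRegular singCentre p 1 G`**: the first floor `Bl_𝔪 G` is not regular. [OURS · instance] -/
theorem not_towerRegular_one_G (k : Type) [Field k] [CharP k 2] (f : MvPolynomial (Fin 5) k) (hf : f = X 0 * X 1 + X 2 ^ 3 + X 3 ^ 3 + X 4 ^ 3) (p : ℕ) :
    ¬ TowerRegular singCentre p 1 (Spec (.of (MvPolynomial (Fin 5) k ⧸ Ideal.span {f}))) := by
  intro h
  have h1 := h (affineBlowup (Ideal.span (Set.range fun j : Fin 5 => Ideal.Quotient.mk (Ideal.span {f}) (X j)))) (affineBlowup.π _)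
    (by rw [singCentre_G_eq_idealSheaf k f hf _ rfl p]; exact affineBlowup.isBlowup _)
  exact not_towerRegular_zero_floor k f hf _ rfl p _ (affineBlowup.π _) (affineBlowup.isBlowup _) h1

/-- ★★★ **THE `singCentre`-TOWER OF `G` HAS HEIGHT EXACTLY TWO** (floors 0 and 1 are not regular, every second floor is). [OURS · one tower instance] -/
theorem towerHeight_G (k : Type) [Field k] [CharP k 2] (f : MvPolynomial (Fin 5) k) (hf : f = X 0 * X 1 + X 2 ^ 3 + X 3 ^ 3 + X 4 ^ 3) (p : ℕ) :
    TowerRegular singCentre p 2 (Spec (.of (MvPolynomial (Fin 5) k ⧸ Ideal.span {f}))) ∧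
      ¬ TowerRegular singCentre p 1 (Spec (.of (MvPolynomial (Fin 5) k ⧸ Ideal.span {f}))) ∧
        ¬ TowerRegular singCentre p 0 (Spec (.of (MvPolynomial (Fin 5) k ⧸ Ideal.span {f}))) :=
  ⟨towerRegular_two_G k f hf p, not_towerRegular_one_G k f hf p, not_towerRegular_zero_G k f hf p⟩

end Summit.ResolutionOfSingularities.ResolutionOfSingularities.Theorems.FInjectiveMacaulayfication.RegTower.InstanceE4

end
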